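import Summits.CriticalPhenomena.Ising3DConformalLimit.Theorems.PrecisionLaplacianDirectCorrelationStableTailClosureModuloCore
import Summits.CriticalPhenomena.Ising3DConformalLimit.Theorems.PrecisionLaplacianDirectCorrelationStableTailMonotoneTauberian
import Summits.CriticalPhenomena.Ising3DConformalLimit.Theorems.PrecisionLaplacianDirectCorrelationStableTailSlabFunctionalLimit
import Summits.CriticalPhenomena.Ising3DConformalLimit.Theorems.PrecisionLaplacianDirectCorrelationStableTailAxisMarginal
import Summits.CriticalPhenomena.Ising3DConformalLimit.Theorems.PrecisionLaplacianDirectCorrelationStableTailScalingOfStableTail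
import HarnessLib

/-!
# Crux `PrecisionLaplacian.DirectCorrelationStableTail` (stmt-CriticalPhenomena-4799) is EQUIVALENT to the stable Lévy
# scaling of the critical direct correlation function — closure of line `self-energy-pick-inversion`, rev 5

Continuation lead of the line (prover-line-stmt-CriticalPhenomena-4799-c1-0, 2026-08-16).  Pure theorem file (no
definitions).  Rev 4 (p121716, `stub_closureModuloCore`) closed the crux modulo the existence core in slab form
(`∃ η ∈ (0,1), c > 0`: pure-power slab sums `S⁽ⁱ⁾(n)·n^{3-η} → c` and convergence of the rescaled tail measures).  Rev 5
replaces that core by its canonical measure-level form and proves the crux EQUIVALENT to it: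

  `StableLevyScalingCore` := under `H` (every finite critical kernel matrix is a symmetric potential) there are `α ∈ (1,2)`
  and an angular profile `Φ` (continuous on `S²`, `≥ 0`, `≢ 0`) with
  `R^α Σ_x a(x) f(x/R) → ∫ f(y) Φ(ŷ)|y|₂^{-3-α} dy` for every `f ∈ C_c(ℝ³ ∖ 0)`, `a = dcf` the direct correlation function

— the step law of the walk dictionary is in the domain of normal attraction of a genuinely three-dimensional symmetric
`α`-stable law with continuous angular Lévy density (`α = 2 − η`).  This is where `η(3) > 0` lives; it is the statement to
promote.

* `stub_closureModuloStableScaling` (registered bookkeeping stub): `StableLevyScalingCore → DirectCorrelationStableTail`.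
  Proof: the rev-4 core follows from the new one — (TMC) is literal; (Rad) by the ISING-FREE landed stubs
  `stub_slabFunctionalLimit` (3-d vague scaling ⇒ slab-sum functionals, using `dcf ∈ ℓ¹` and evenness from
  `stub_dcfStructure`), `stub_axisMarginal` (dilation identity `∫ g(|y_i|)Φ(ŷ)|y|^{-3-α} = F ∫ g s^{-1-α}`, `F > 0`) and
  `stub_monotoneTauberian` (monotone-density Tauberian step on `ℕ`; the slab sums are non-increasing by the Hausdorff
  structure = landed Pick inversion), direction-independence of the slab sums by hyperoctahedral invariance; then
  `stub_closureModuloCore`.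
* `stableLevyScalingCore_of_directCorrelationStableTail`: the converse, by the Ising-free landed `stub_scalingOfStableTail`
  (lattice Riemann sums).
* `directCorrelationStableTail_iff_stableLevyScalingCore`: the equivalence.
-/

noncomputable section

namespace Summit.CriticalPhenomena.Ising3DConformalLimit.Cruxes.DirectCorrelationStableTail.SelfEnergyPickInversion

open MeasureTheory Filter Topology
open scoped BigOperators
open Literature.Probability.LatticeModels

/-- Sign-flip invariance in the three coordinates gives evenness `a(−x) = a(x)`. [folklore] -/
theorem even_of_coordinate_flips {a : Site 3 → ℝ}
    (hflip : ∀ (j : Fin 3) (x : Site 3), a (Function.update x j (-x j)) = a x) (x : Site 3) :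
    a (-x) = a x := by
  have key : -x = Function.update (Function.update (Function.update x 0 (-x 0)) 1
      (-(Function.update x 0 (-x 0)) 1)) 2
      (-(Function.update (Function.update x 0 (-x 0)) 1 (-(Function.update x 0 (-x 0)) 1)) 2) := by
    ext j
    fin_cases j <;> simp [Function.update]
  rw [key, hflip 2, hflip 1, hflip 0]

/-- Coordinate-permutation invariance makes the slab sums `Σ_{y ∈ ℤ²} a(insertNth i n y)` independent of the
direction `i`. [folklore] -/
theorem tsum_slab_eq_tsum_slab_zero {a : Site 3 → ℝ}
    (hperm : ∀ (σ : Equiv.Perm (Fin 3)) (x : Site 3), a (fun j => x (σ j)) = a x) (i : Fin 3) (n : ℕ) :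
    (∑' y : Fin 2 → ℤ, a (Fin.insertNth i (n : ℤ) (y) : Site 3)) =
      ∑' y : Fin 2 → ℤ, a (Fin.insertNth 0 (n : ℤ) (y) : Site 3) := by
  refine tsum_congr fun y => ?_
  have h1 : a (Fin.insertNth 1 (n : ℤ) y : Site 3) = a (Fin.insertNth 0 (n : ℤ) y : Site 3) := by
    rw [← hperm (Equiv.swap 0 1) (Fin.insertNth 1 (n : ℤ) y)]
    congr 1
    ext j
    fin_cases j <;> rfl
  have h2 : a (Fin.insertNth 2 (n : ℤ) y : Site 3) = a (Fin.insertNth 0 (n : ℤ) y : Site 3) := by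
    rw [← hperm (finRotate 3).symm (Fin.insertNth 2 (n : ℤ) y)]
    congr 1
    ext j
    fin_cases j <;> rfl
  fin_cases i
  · rfl
  · exact h1
  · exact h2

/-- The Hausdorff structure of the slab modes (here only needed at zero transverse momentum) makes the slab sums
nonnegative and non-increasing from `n = 1` on. [folklore] -/
theorem slab_tsum_antitone_of_hausdorff {a : Site 3 → ℝ} (i : Fin 3)
    (hHaus : ∀ k : Fin 2 → ℝ, ∃ τ : MeasureTheory.Measure ℝ, MeasureTheory.IsFiniteMeasure τ ∧
      τ (Set.Icc (0 : ℝ) 1)ᶜ = 0 ∧ ∀ n : ℕ, 1 ≤ n → (∑' y : Fin 2 → ℤ, a (Fin.insertNth i (n : ℤ) (y) : Site 3) *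
        Real.cos (∑ j, k j * (y j : ℝ))) = ∫ t, t ^ (n - 1) ∂τ) :
    (∀ n : ℕ, 1 ≤ n → 0 ≤ ∑' y : Fin 2 → ℤ, a (Fin.insertNth i (n : ℤ) (y) : Site 3)) ∧
      ∀ n : ℕ, 1 ≤ n → (∑' y : Fin 2 → ℤ, a (Fin.insertNth i ((n + 1 : ℕ) : ℤ) (y) : Site 3)) ≤
        ∑' y : Fin 2 → ℤ, a (Fin.insertNth i (n : ℤ) (y) : Site 3) := by
  obtain ⟨τ, hfin, hsupp, hmom⟩ := hHaus 0
  have hmode : ∀ n : ℕ, (∑' y : Fin 2 → ℤ, a (Fin.insertNth i (n : ℤ) (y) : Site 3) *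
      Real.cos (∑ j, (0 : Fin 2 → ℝ) j * (y j : ℝ))) = ∑' y : Fin 2 → ℤ, a (Fin.insertNth i (n : ℤ) (y) : Site 3) :=
    fun n => tsum_congr fun y => by simp
  have hae : ∀ᵐ t ∂τ, t ∈ Set.Icc (0 : ℝ) 1 := by
    rw [MeasureTheory.ae_iff]
    simpa only [Set.mem_setOf_eq, ← Set.mem_compl_iff, Set.setOf_mem_eq] using hsupp
  have hint : ∀ k : ℕ, MeasureTheory.Integrable (fun t : ℝ => t ^ k) τ := by
    intro k
    refine MeasureTheory.Integrable.mono' (MeasureTheory.integrable_const (1 : ℝ))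
      (measurable_id.pow_const k).aestronglyMeasurable (hae.mono fun t ht => ?_)
    rw [Real.norm_eq_abs, abs_pow, abs_of_nonneg ht.1]
    exact pow_le_one₀ ht.1 ht.2
  refine ⟨fun n hn => ?_, fun n hn => ?_⟩
  · rw [← hmode, hmom n hn]
    exact MeasureTheory.integral_nonneg_of_ae (hae.mono fun t ht => pow_nonneg ht.1 _)
  · rw [← hmode, ← hmode, hmom (n + 1) (by omega), hmom n hn]
    refine MeasureTheory.integral_mono_ae (hint _) (hint _) (hae.mono fun t ht => ?_)
    exact pow_le_pow_of_le_one ht.1 ht.2 (by omega)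

/-- **The crux follows from the stable Lévy scaling of the critical direct correlation function** (registered
bookkeeping stub `stub_closureModuloStableScaling`; the hypothesis is the registered signature of the open core stub
`stub_stableLevyScaling`, verbatim).  `η := 2 − α`, `c := F₀/2`. -/
theorem stub_closureModuloStableScaling :
    ((∀ A : Finset (Site 3), (Matrix.of fun (p q : ↥A) => criticalTwoPoint 3 (q.1 - p.1)).PosDef ∧ ∀ u v : ↥A,
      (u ≠ v → (Matrix.of fun (p q : ↥A) => criticalTwoPoint 3 (q.1 - p.1))⁻¹ u v ≤ 0) ∧ 0 ≤ ∑ w, (Matrix.of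
      fun (p q : ↥A) => criticalTwoPoint 3 (q.1 - p.1))⁻¹ u w) → ∃ (α : ℝ) (Φ : (Fin 3 → ℝ) → ℝ), 1 < α ∧ α < 2
      ∧ ContinuousOn Φ {u | ∑ i, u i ^ 2 = 1} ∧ (∀ u : Fin 3 → ℝ, ∑ i, u i ^ 2 = 1 → 0 ≤ Φ u) ∧ (∃ u : Fin 3 →
      ℝ, ∑ i, u i ^ 2 = 1 ∧ 0 < Φ u) ∧ ∀ f : (Fin 3 → ℝ) → ℝ, Continuous f → HasCompactSupport f → (0 : Fin 3 →
      ℝ) ∉ tsupport f → Filter.Tendsto (fun R : ℕ => (R : ℝ) ^ α * ∑' x : Site 3, (⨅ A : {A : Finset (Site 3)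
      // (0 : Site 3) ∈ A ∧ x ∈ A}, -((Matrix.of fun (p q : ↥A.1) => criticalTwoPoint 3 (q.1 - p.1))⁻¹ ⟨0,
      A.2.1⟩ ⟨x, A.2.2⟩)) * f (fun j => (x j : ℝ) / (R : ℝ))) Filter.atTop (nhds (∫ y : Fin 3 → ℝ, f y * (Φ
      (fun j => y j / Real.sqrt (∑ l, y l ^ 2)) * Real.sqrt (∑ l, y l ^ 2) ^ (-(3 + α)))))) →
    Summit.CriticalPhenomena.Ising3DConformalLimit.Theses.PrecisionLaplacian.DirectCorrelationStableTail := by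
  intro h6
  refine stub_closureModuloCore ?_
  intro hH hsum hHaus _hGap
  set a : Site 3 → ℝ := fun x : Site 3 => (⨅ A : {A : Finset (Site 3) // (0 : Site 3) ∈ A ∧ x ∈ A}, -((Matrix.of fun (p q : ↥A.1) => criticalTwoPoint 3 (q.1 - p.1))⁻¹ ⟨0, A.2.1⟩ ⟨x, A.2.2⟩))
  obtain ⟨α, Φ, hα1, hα2, hΦc, hΦ0, hΦpos, hscal⟩ := h6 hH
  have hα0 : 0 < α := by linarith
  -- structure of the direct correlation function: nonnegative off 0, hyperoctahedrally invariant, even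
  have hnn : ∀ x : Site 3, x ≠ 0 → 0 ≤ a x := by
    intro x hx
    haveI : Nonempty {A : Finset (Site 3) // (0 : Site 3) ∈ A ∧ x ∈ A} := ⟨⟨{0, x}, by simp, by simp⟩⟩
    refine le_ciInf fun A => ?_
    exact neg_nonneg.2 (((hH A.1).2 _ _).1 fun e => hx (Subtype.ext_iff.mp e).symm)
  obtain ⟨-, hperm, hflip⟩ := stub_dcfStructure hH
  have heven : ∀ x : Site 3, a (-x) = a x := fun x => even_of_coordinate_flips (a := a) hflip x
  -- the dilation identity and integrability of the limit density (stub 10, direction 0)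
  obtain ⟨hint, F, hF, hmarg⟩ := stub_axisMarginal α Φ 0 hα0 hΦc hΦ0 hΦpos
  -- the slab-sum functionals converge (stub 9)
  have hslab := stub_slabFunctionalLimit a α
    (fun y : Fin 3 → ℝ => Φ (fun j => y j / Real.sqrt (∑ l, y l ^ 2)) * Real.sqrt (∑ l, y l ^ 2) ^ (-(3 + α)))
    0 hα0 hnn hsum heven hint hscal
  -- monotonicity of the slab sums (Hausdorff structure at zero transverse momentum)
  have hmono := slab_tsum_antitone_of_hausdorff (a := a) 0 (hHaus 0)
  -- the Tauberian step (stub 8)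
  have hrad0 : Filter.Tendsto (fun n : ℕ => (∑' y : Fin 2 → ℤ, a (Fin.insertNth 0 (n : ℤ) (y) : Site 3)) *
      (n : ℝ) ^ (1 + α)) Filter.atTop (nhds (F / 2)) := by
    refine stub_monotoneTauberian (fun n : ℕ => ∑' y : Fin 2 → ℤ, a (Fin.insertNth 0 (n : ℤ) (y) : Site 3)) α
      (F / 2) hα0 hmono.1 hmono.2 fun g hg hgc hgs => ?_
    have key : Filter.Tendsto (fun R : ℕ => (R : ℝ) ^ α * ∑' n : ℕ, (∑' y : Fin 2 → ℤ,
        a (Fin.insertNth 0 (n : ℤ) (y) : Site 3)) * g ((n : ℝ) / (R : ℝ))) Filter.atTop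
        (nhds ((1 / 2 : ℝ) * (F * ∫ s in Set.Ioi (0 : ℝ), g s * s ^ (-(1 + α))))) := by
      simpa only [hmarg g hg hgc hgs] using hslab g hg hgc hgs
    convert key using 2
    ring
  refine ⟨2 - α, F / 2, by linarith, by linarith, by positivity, fun i => ?_, fun f hf hfc hf0 =>
    ⟨∫ y : Fin 3 → ℝ, f y * (Φ (fun j => y j / Real.sqrt (∑ l, y l ^ 2)) * Real.sqrt (∑ l, y l ^ 2) ^ (-(3 + α))), ?_⟩⟩
  · refine Filter.Tendsto.congr (fun n => ?_) hrad0
    show (∑' y : Fin 2 → ℤ, a (Fin.insertNth 0 (n : ℤ) (y) : Site 3)) * (n : ℝ) ^ (1 + α) =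
      (∑' y : Fin 2 → ℤ, a (Fin.insertNth i (n : ℤ) (y) : Site 3)) * (n : ℝ) ^ (3 - (2 - α))
    rw [tsum_slab_eq_tsum_slab_zero hperm i n, show (3 : ℝ) - (2 - α) = 1 + α by ring]
  · refine Filter.Tendsto.congr (fun R => ?_) (hscal f hf hfc hf0)
    show (R : ℝ) ^ α * (∑' x : Site 3, a x * f (fun j => (x j : ℝ) / (R : ℝ))) =
      (R : ℝ) ^ (2 - (2 - α)) * ∑' x : Site 3, a x * f (fun j => (x j : ℝ) / (R : ℝ))
    rw [show (2 : ℝ) - (2 - α) = α by ring]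

/-- **Necessity**: the crux implies the stable Lévy scaling of the critical direct correlation function (index `2 − η`,
the same angular profile), by the Ising-free lattice-Riemann-sum stub `stub_scalingOfStableTail`. -/
theorem stableLevyScalingCore_of_directCorrelationStableTail
    (h : Summit.CriticalPhenomena.Ising3DConformalLimit.Theses.PrecisionLaplacian.DirectCorrelationStableTail) :
    (∀ A : Finset (Site 3), (Matrix.of fun (p q : ↥A) => criticalTwoPoint 3 (q.1 - p.1)).PosDef ∧ ∀ u v : ↥A,
      (u ≠ v → (Matrix.of fun (p q : ↥A) => criticalTwoPoint 3 (q.1 - p.1))⁻¹ u v ≤ 0) ∧ 0 ≤ ∑ w, (Matrix.of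
      fun (p q : ↥A) => criticalTwoPoint 3 (q.1 - p.1))⁻¹ u w) → ∃ (α : ℝ) (Φ : (Fin 3 → ℝ) → ℝ), 1 < α ∧ α < 2
      ∧ ContinuousOn Φ {u | ∑ i, u i ^ 2 = 1} ∧ (∀ u : Fin 3 → ℝ, ∑ i, u i ^ 2 = 1 → 0 ≤ Φ u) ∧ (∃ u : Fin 3 →
      ℝ, ∑ i, u i ^ 2 = 1 ∧ 0 < Φ u) ∧ ∀ f : (Fin 3 → ℝ) → ℝ, Continuous f → HasCompactSupport f → (0 : Fin 3 →
      ℝ) ∉ tsupport f → Filter.Tendsto (fun R : ℕ => (R : ℝ) ^ α * ∑' x : Site 3, (⨅ A : {A : Finset (Site 3)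
      // (0 : Site 3) ∈ A ∧ x ∈ A}, -((Matrix.of fun (p q : ↥A.1) => criticalTwoPoint 3 (q.1 - p.1))⁻¹ ⟨0,
      A.2.1⟩ ⟨x, A.2.2⟩)) * f (fun j => (x j : ℝ) / (R : ℝ))) Filter.atTop (nhds (∫ y : Fin 3 → ℝ, f y * (Φ
      (fun j => y j / Real.sqrt (∑ l, y l ^ 2)) * Real.sqrt (∑ l, y l ^ 2) ^ (-(3 + α))))) := by
  intro hH
  obtain ⟨η, Φ, hη0, hη1, hΦc, hΦ0, hΦpos, htail⟩ := h hH
  refine ⟨2 - η, Φ, by linarith, by linarith, hΦc, hΦ0, hΦpos, fun f hf hfc hf0 => ?_⟩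
  have key := stub_scalingOfStableTail (fun x : Site 3 => (⨅ A : {A : Finset (Site 3) // (0 : Site 3) ∈ A ∧ x ∈ A}, -((Matrix.of fun (p q : ↥A.1) => criticalTwoPoint 3 (q.1 - p.1))⁻¹ ⟨0, A.2.1⟩ ⟨x, A.2.2⟩))) η Φ hΦc htail f hf hfc hf0
  have e : (-(3 + (2 - η)) : ℝ) = -(5 - η) := by ring
  simp_rw [e]
  exact key

/-- **The crux `DirectCorrelationStableTail` is EQUIVALENT to the stable Lévy scaling of the critical direct correlation
function** (the open core of line self-energy-pick-inversion, rev 5). -/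
theorem directCorrelationStableTail_iff_stableLevyScalingCore :
    Summit.CriticalPhenomena.Ising3DConformalLimit.Theses.PrecisionLaplacian.DirectCorrelationStableTail ↔
    ((∀ A : Finset (Site 3), (Matrix.of fun (p q : ↥A) => criticalTwoPoint 3 (q.1 - p.1)).PosDef ∧ ∀ u v : ↥A,
      (u ≠ v → (Matrix.of fun (p q : ↥A) => criticalTwoPoint 3 (q.1 - p.1))⁻¹ u v ≤ 0) ∧ 0 ≤ ∑ w, (Matrix.of
      fun (p q : ↥A) => criticalTwoPoint 3 (q.1 - p.1))⁻¹ u w) → ∃ (α : ℝ) (Φ : (Fin 3 → ℝ) → ℝ), 1 < α ∧ α < 2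
      ∧ ContinuousOn Φ {u | ∑ i, u i ^ 2 = 1} ∧ (∀ u : Fin 3 → ℝ, ∑ i, u i ^ 2 = 1 → 0 ≤ Φ u) ∧ (∃ u : Fin 3 →
      ℝ, ∑ i, u i ^ 2 = 1 ∧ 0 < Φ u) ∧ ∀ f : (Fin 3 → ℝ) → ℝ, Continuous f → HasCompactSupport f → (0 : Fin 3 →
      ℝ) ∉ tsupport f → Filter.Tendsto (fun R : ℕ => (R : ℝ) ^ α * ∑' x : Site 3, (⨅ A : {A : Finset (Site 3)
      // (0 : Site 3) ∈ A ∧ x ∈ A}, -((Matrix.of fun (p q : ↥A.1) => criticalTwoPoint 3 (q.1 - p.1))⁻¹ ⟨0,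
      A.2.1⟩ ⟨x, A.2.2⟩)) * f (fun j => (x j : ℝ) / (R : ℝ))) Filter.atTop (nhds (∫ y : Fin 3 → ℝ, f y * (Φ
      (fun j => y j / Real.sqrt (∑ l, y l ^ 2)) * Real.sqrt (∑ l, y l ^ 2) ^ (-(3 + α)))))) :=
  ⟨stableLevyScalingCore_of_directCorrelationStableTail, stub_closureModuloStableScaling⟩

end Summit.CriticalPhenomena.Ising3DConformalLimit.Cruxes.DirectCorrelationStableTail.SelfEnergyPickInversion

end
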